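import Summits.HubbardSuperconductivity.HubbardSuperconductivity.Theorems.JosephsonMirrorPairBridgeGivesGain
import Summits.HubbardSuperconductivity.HubbardSuperconductivity.Theorems.WeakCouplingBCSWcbcsSsbToTorusLROMomentClosure
import Summits.HubbardSuperconductivity.HubbardSuperconductivity.Theorems.EnslavedA1gA1gSlavingTransfer
import Literature.MathematicalPhysics.QuantumLattice.DWaveSourceProofs
import Literature.MathematicalPhysics.QuantumLattice.SectorSpectrum
import Summits.HubbardSuperconductivity.HubbardSuperconductivity.Theorems.CwSsbToEvenTorusLRO.Negative.RepelledOrderKappaThreshold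

/-!
# Route `JosephsonMirror`, crux `JmCusp` (stmt-HubbardSuperconductivity-2228), line `Sketch`:
# tools for the de-doubling inequality

Registered stub `stub_deformedGroundState` of the lead skeleton `Cruxes/JmCusp/Lines/Sketch.lean` plus the
norm riders used by the lead's stub `stub_dedouble` (`ZeroModeCusp ⇒ JosephsonGain`, landed separately):

* `pairField_mul_conjTranspose_mulVec_mem_szSector`, `stub_deformedGroundState` (registered stub) — the
  deformed layer `H_c = hubbardTorus 2 L 1 U − c Δ_d Δ_dᴴ` leaves every joint sector
  `(2k, S^z = 0)` invariant and has a normalised sector ground state there (`sector_groundState`);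
* `norm_pairField_dWave_sq_le` — `‖Δ_d‖² ≤ 32 L⁴` (via the tree's `sum_abs_dWaveFormFactor_div_sqrt_two_eq`);
* `norm_commutator_hubbardTorus_pairField_conjTranspose_le` — `‖[H, Δ_dᴴ]‖ ≤ K L²` (adjoint of the
  tree's single-commutator locality bound);
* `deform_strength_le_half` — the elementary `J a'/(2(a'+32)) ≤ J/2`.

Sources: H. Tasaki, *Physics and Mathematics of Quantum Many-Body Systems* (2020) §2.2 (sector
variational principle); D. J. Scalapino, Phys. Rep. 250 (1995) 329 §2 (pair field); M. B. Hastings,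
T. Koma, CMP 265 (2006) 781 App. A (commutator locality). No new definitions.
-/

-- the mandated namespace `Summit.<Summit>.<Problem>.Theorems` repeats `HubbardSuperconductivity`
-- (single-problem summit, D-0017), which the `dupNamespace` linter flags on every declaration
set_option linter.dupNamespace false

namespace Summit.HubbardSuperconductivity.HubbardSuperconductivity.Theorems.JosephsonMirror

open Matrix Literature.MathematicalPhysics.QuantumLattice Literature.Probability.LatticeModels
open scoped ComplexOrder Matrix.Norms.L2Operator

/-! ### The deformed layer `H − c Δ Δᴴ` has a ground state in the sector `(2k, S^z = 0)` -/

section Deformed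

variable {L : ℕ} [NeZero L]

/-- `Δ Δᴴ` maps the joint sector `(2k, S^z = 0)` into itself (`Δᴴ` raises, `Δ` lowers the
particle number by two at fixed `S^z`). [folklore] -/
theorem pairField_mul_conjTranspose_mulVec_mem_szSector (k : ℕ) {v : Fock (Orb (FermionTorus 2 L))}
    (hv : v ∈ szSector (2 * k) 0) :
    (pairField dWaveFormFactor L * (pairField dWaveFormFactor L)ᴴ) *ᵥ v ∈ szSector (2 * k) 0 := by
  rw [← mulVec_mulVec]
  have h1 : (pairField dWaveFormFactor L)ᴴ *ᵥ v ∈ szSector (2 * k + 2) 0 := by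
    have h := WcbcsSsbToTorusLRO.conjTranspose_pairFieldAt_mulVec_mem_szSector dWaveFormFactor
      (0 : TorusSite 2 L) hv
    rwa [pairFieldAt_zero] at h
  have h2 := WcbcsSsbToTorusLRO.pairFieldAt_mulVec_mem_szSector dWaveFormFactor (0 : TorusSite 2 L)
    (N := 2 * k + 2) (by omega) h1
  rw [pairFieldAt_zero] at h2
  simpa using h2

end Deformed

section DeformedStub

/-- **Stub `stub_deformedGroundState`** (line `Sketch`, crux `JmCusp`; registered signature) — **the deformed
layer has a sector ground state.** For real `c` and `k ≤ L²`, the Hermitian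
matrix `H_c = hubbardTorus 2 L 1 U − c Δ_d Δ_dᴴ` leaves the coordinate sector
`szSector (2k) 0` invariant, so it has a normalised eigenvector there with eigenvalue its sector
energy `minEnergyOn H_c (szSector (2k) 0)` (`sector_groundState`). Tasaki (2020) §2.2. [folklore] -/
theorem stub_deformedGroundState {L : ℕ} [NeZero L] (U c : ℝ) {k : ℕ} (hk : k ≤ L ^ 2) :
    ∃ φ : Literature.MathematicalPhysics.QuantumLattice.Fock (Literature.MathematicalPhysics.QuantumLattice.Orb (Literature.MathematicalPhysics.QuantumLattice.FermionTorus 2 L)),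
      φ ∈ Literature.MathematicalPhysics.QuantumLattice.szSector (2 * k) 0 ∧ star φ ⬝ᵥ φ = 1 ∧
      (Literature.MathematicalPhysics.QuantumLattice.hubbardTorus 2 L 1 U - (c : ℂ) •
          (Literature.MathematicalPhysics.QuantumLattice.pairField Literature.MathematicalPhysics.QuantumLattice.dWaveFormFactor L *
            (Literature.MathematicalPhysics.QuantumLattice.pairField Literature.MathematicalPhysics.QuantumLattice.dWaveFormFactor L)ᴴ)).mulVec φ =
        (((Literature.MathematicalPhysics.QuantumLattice.hubbardTorus 2 L 1 U - (c : ℂ) •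
            (Literature.MathematicalPhysics.QuantumLattice.pairField Literature.MathematicalPhysics.QuantumLattice.dWaveFormFactor L *
              (Literature.MathematicalPhysics.QuantumLattice.pairField Literature.MathematicalPhysics.QuantumLattice.dWaveFormFactor L)ᴴ)).minEnergyOn
              (Literature.MathematicalPhysics.QuantumLattice.szSector (2 * k) 0) : ℝ) : ℂ) • φ := by
  classical
  set P : Matrix (Finset (Orb (FermionTorus 2 L))) (Finset (Orb (FermionTorus 2 L))) ℂ :=
    pairField dWaveFormFactor L with hP
  set Hc := hubbardTorus 2 L 1 U - (c : ℂ) • (P * Pᴴ) with hHc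
  -- Hermitian
  have hHerm : Hc.IsHermitian := by
    have h1 : (hubbardTorus 2 L 1 U).IsHermitian := by
      have := isHermitian_hamiltonianWith (fermionTorusGraph 2 L) 1 U 0
      rwa [show hamiltonianWith (fermionTorusGraph 2 L) 1 U 0 = hubbardTorusWith 2 L 1 U 0 from rfl,
        hubbardTorusWith_zero] at this
    have h2 : (P * Pᴴ).IsHermitian := Matrix.isHermitian_mul_conjTranspose_self P
    exact h1.sub (h2.smul (Complex.conj_ofReal c))
  -- the sector predicate
  set p : Finset (Orb (FermionTorus 2 L)) → Prop := fun s =>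
    (upPart s).card = k ∧ (downPart s).card = k with hp
  have hK : ∀ v : Fock (Orb (FermionTorus 2 L)), v ∈ szSector (2 * k) (0 : ℝ) ↔ ∀ s, ¬ p s → v s = 0 :=
    fun v => mem_szSector_two_mul_zero_iff k v
  -- nonempty sector
  have hcard : k ≤ Fintype.card (FermionTorus 2 L) := by rwa [card_fermionTorus]
  obtain ⟨α₀, -, hα₀⟩ : ∃ α₀ : Finset (FermionTorus 2 L), α₀ ⊆ Finset.univ ∧ α₀.card = k :=
    Finset.exists_subset_card_eq (by rwa [Finset.card_univ])
  have hpex : ∃ s, p s := ⟨pairSet α₀ α₀, by rw [hp]; simp [hα₀]⟩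
  -- invariance, entrywise
  have hinv : ∀ i j, ¬ p i → p j → Hc i j = 0 := by
    intro i j hi hj
    have hH : hubbardTorus 2 L 1 U i j = 0 := by
      by_contra h
      have := LiebThm1.preservesSectors_hamiltonian (fermionTorusGraph 2 L) 1 U i j h
      exact hi ⟨this.1.trans hj.1, this.2.trans hj.2⟩
    have hPP : (P * Pᴴ) i j = 0 := by
      have hcol : (P * Pᴴ) i j = ((P * Pᴴ) *ᵥ Pi.single j 1) i := by
        rw [mulVec_single_one]; rfl
      have hmem : (Pi.single j (1 : ℂ) : Fock (Orb (FermionTorus 2 L))) ∈ szSector (2 * k) (0 : ℝ) := by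
        refine (hK _).2 fun s hs => ?_
        have hsj : s ≠ j := fun h => hs (h ▸ hj)
        simp [hsj]
      have hout := (hK _).1 (pairField_mul_conjTranspose_mulVec_mem_szSector k hmem) i hi
      rw [hcol]
      exact hout
    rw [hHc, Matrix.sub_apply, Matrix.smul_apply, hH, hPP, smul_zero, sub_zero]
  obtain ⟨⟨v, hv, hv0, hHv⟩, -⟩ :=
    sector_groundState Hc hHerm p hpex hinv (szSector (2 * k) 0) hK
  obtain ⟨c₀, -, hc₀⟩ := exists_smul_unit hv0
  refine ⟨c₀ • v, Submodule.smul_mem _ c₀ hv, hc₀, ?_⟩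
  rw [mulVec_smul, hHv, smul_comm]

end DeformedStub


/-! ### Norm bookkeeping: `‖Δ_d‖² ≤ 32 L⁴`, `‖[H, Δ_dᴴ]‖ ≤ K L²` -/

section Norms

variable (L : ℕ) [NeZero L]

/-- `‖Δ_d‖² ≤ 32 L⁴` (`‖Δ_d‖ ≤ 2 · (4/√2) · L² = 4√2 L²`, `norm_pairField_le` and the tree's
`sum_abs_dWaveFormFactor_div_sqrt_two_eq`). [folklore] -/
theorem norm_pairField_dWave_sq_le : ‖pairField dWaveFormFactor L‖ ^ 2 ≤ 32 * (L : ℝ) ^ 4 := by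
  have h := norm_pairField_le dWaveFormFactor L
  rw [CwSsbToEvenTorusLRO.Negative.sum_abs_dWaveFormFactor_div_sqrt_two_eq] at h
  have hs : 0 < Real.sqrt 2 := Real.sqrt_pos.2 two_pos
  have hs2 : Real.sqrt 2 ^ 2 = 2 := Real.sq_sqrt two_pos.le
  have hc : (2 * (4 / Real.sqrt 2)) ^ 2 = 32 := by
    rw [mul_pow, div_pow, hs2]; norm_num
  calc ‖pairField dWaveFormFactor L‖ ^ 2 ≤ (2 * (4 / Real.sqrt 2) * (L : ℝ) ^ 2) ^ 2 :=
        pow_le_pow_left₀ (norm_nonneg _) h 2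
    _ = 32 * (L : ℝ) ^ 4 := by rw [mul_pow, hc]; ring

/-- `‖[H, Δ_dᴴ]‖ = ‖[H, Δ_d]‖ ≤ K L²` with the tree's single-commutator constant
`K = (Σ_e ‖d(e)/√2‖) · 72 (2 + |U|)` (`norm_commutator_hubbardTorus_pairField_le`, adjoint). [folklore] -/
theorem norm_commutator_hubbardTorus_pairField_conjTranspose_le (U : ℝ) :
    ‖hubbardTorus 2 L 1 U * (pairField dWaveFormFactor L)ᴴ -
        (pairField dWaveFormFactor L)ᴴ * hubbardTorus 2 L 1 U‖ ≤
      (∑ e ∈ insert (0 : Site 2) unitSteps, ‖((dWaveFormFactor e / Real.sqrt 2 : ℝ) : ℂ)‖) *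
        (72 * (2 + |U|)) * (L : ℝ) ^ 2 := by
  have h := Summit.HubbardSuperconductivity.EnslavedA1g.norm_commutator_hubbardTorus_pairField_le
    dWaveFormFactor U L
  have hH : (hubbardTorus 2 L 1 U)ᴴ = hubbardTorus 2 L 1 U := by
    have := isHermitian_hamiltonianWith (fermionTorusGraph 2 L) 1 U 0
    rw [show hamiltonianWith (fermionTorusGraph 2 L) 1 U 0 = hubbardTorusWith 2 L 1 U 0 from rfl,
      hubbardTorusWith_zero] at this
    exact this.eq
  have hadj : hubbardTorus 2 L 1 U * (pairField dWaveFormFactor L)ᴴ -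
      (pairField dWaveFormFactor L)ᴴ * hubbardTorus 2 L 1 U =
      -(hubbardTorus 2 L 1 U * pairField dWaveFormFactor L -
        pairField dWaveFormFactor L * hubbardTorus 2 L 1 U)ᴴ := by
    rw [conjTranspose_sub, conjTranspose_mul, conjTranspose_mul, hH, neg_sub]
  rw [hadj, norm_neg, Matrix.l2_opNorm_conjTranspose]
  exact h

end Norms

/-! ### Arithmetic of the deformation strength -/

section Arith

/-- `J a'/(2(a'+32)) ≤ J/2` for `a' > 0`, `J ≥ 0`. [folklore] -/
theorem deform_strength_le_half {J a' : ℝ} (hJ : 0 ≤ J) (ha : 0 < a') :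
    J * a' / (2 * (a' + 32)) ≤ J / 2 := by
  rw [div_le_div_iff₀ (by positivity) (by norm_num : (0:ℝ) < 2)]
  nlinarith [mul_nonneg hJ ha.le]

end Arith

end Summit.HubbardSuperconductivity.HubbardSuperconductivity.Theorems.JosephsonMirror
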